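import Summits.BirchSwinnertonDyer.BirchSwinnertonDyer.Theses.LeadingTerm
import Literature.NumberTheory.EllipticCurves.CyclotomicIwasawaMainTheoremIrreducible
import Literature.NumberTheory.EllipticCurves.ModPIrreducibleCofinite
import Literature.NumberTheory.EllipticCurves.PAdicBSD

/-!
# BirchSwinnertonDyer / LeadingTerm — crux `PinchPrime` (stmt-BirchSwinnertonDyer-16218),
# line `SketchIdeator2`, stub `stub_cofiniteTorsion` (GLUE)

Registered stub of the lead skeleton `Cruxes/PinchPrime` (line `SketchIdeator2`): the Iwasawa
module `X(E/ℚ_∞) = D.X` is a TORSION `Λ`-module, COFINITELY in `p`. For an elliptic curve `E/ℚ`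
(globally minimal `W`) there is a finite set `B` of naturals such that for every good ordinary
prime `p ≥ 5`, `p ∉ B`, every cyclotomic datum `(κ, γ)` (`κ` the cyclotomic `ℤ_p`-extension,
`γ` a topological generator matching the cyclotomic variable `T`), every newform `f` of `E` and
every Iwasawa datum `D` for `X = X(E/ℚ_∞)`, `D.X` is `Λ`-torsion (`D.IsTorsion`).

The deep input is the HYPOTHESIS `burungale_castella_skinner_charIdeal_eq_padicLFunction`
(Burungale–Castella–Skinner, IMRN 2025, Thm. 1.1.2 (a): for `p ≥ 5` good ordinary with `E[p]`
irreducible, `X` is `Λ`-torsion and `char_Λ X = (g)` with `ι g = p^k · L_p(f, α_p, T)`); only its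
first conclusion is used here. Its only hypothesis not among the stub's binders, irreducibility
of `E[p]`, holds for all primes `p > N₀`
(`WeierstrassCurve.exists_forall_hasIrreducibleModPGaloisRep_of_lt`, Silverman *AEC* Cor. IX.6.3,
PROVED in the tree), whence `B := {0, …, N₀}`.
-/

noncomputable section

set_option linter.dupNamespace false

namespace Summit.BirchSwinnertonDyer.BirchSwinnertonDyer.Cruxes.PinchPrime.FirstLayerStability

open scoped MatrixGroups ModularForm
open CongruenceSubgroup Literature.NumberTheory.EllipticCurves
  Literature.NumberTheory.EllipticCurves.ModularForms
open Summit.BirchSwinnertonDyer.BirchSwinnertonDyer.Theses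

/-- **`X(E/ℚ_∞)` is `Λ`-torsion, cofinitely in `p`** (stub `stub_cofiniteTorsion` of crux
`PinchPrime`, line `SketchIdeator2`). Assume
`burungale_castella_skinner_charIdeal_eq_padicLFunction` (Burungale–Castella–Skinner 2025,
Thm. 1.1.2 (a)). Then for every elliptic `E/ℚ` (globally minimal `W`) there is a finite set `B` of
naturals such that for every prime `p ∉ B` with `p ≥ 5` of good ordinary reduction, every
cyclotomic `ℤ_p`-extension `κ` with topological generator `γ` matching the cyclotomic variable,
every newform `f` of `E` and every Iwasawa datum `D`: the Iwasawa module `D.X = X(E/ℚ_∞)` is a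
torsion `Λ`-module. Take `B = {0, …, N₀}` with `E[p]` irreducible for all primes `p > N₀`
(`WeierstrassCurve.exists_forall_hasIrreducibleModPGaloisRep_of_lt`); then BCS applies at every
prime `p ∉ B` and its first conclusion is `D.IsTorsion`.
[cite: BurungaleCastellaSkinner2025, Thm. 1.1.2 (a)] -/
theorem stub_cofiniteTorsion :
    burungale_castella_skinner_charIdeal_eq_padicLFunction →
    ∀ (W : WeierstrassCurve ℚ) [W.IsElliptic] [W.IsGloballyMinimal],
      ∃ B : Finset ℕ, ∀ p ∉ B, ∀ [Fact p.Prime], 5 ≤ p → IsOrdinaryAt W p →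
        ∀ (κ : ZpExtension ℚ p) (γ : Field.absoluteGaloisGroup ℚ),
          κ.IsCyclotomic → κ.IsTopGenerator γ → IsCyclotomicVariable p γ →
        ∀ {N : ℕ} [NeZero N] (f : CuspForm (Gamma0 N) 2), IsNewformOf W f →
        ∀ D : W.SelmerDualData κ γ, D.IsTorsion := by
  intro hBCS W _ _
  -- the finitely many primes with `E[p]` reducible
  obtain ⟨N₀, hN₀⟩ := W.exists_forall_hasIrreducibleModPGaloisRep_of_lt
  refine ⟨Finset.range (N₀ + 1), ?_⟩
  intro p hpB _ h5 hord κ γ hκ hγ hγ' N _ f hf D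
  have hNp : N₀ < p := by
    rw [Finset.mem_range, not_lt] at hpB
    omega
  have hirr : W.HasIrreducibleModPGaloisRep p := hN₀ p hNp Fact.out
  -- the first conclusion of BCS: `X(E/ℚ_∞)` is `Λ`-torsion
  exact (hBCS W p κ γ f h5 hord.1 hord.2 hirr hκ hγ hγ' hf D).1

end Summit.BirchSwinnertonDyer.BirchSwinnertonDyer.Cruxes.PinchPrime.FirstLayerStability

end
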